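import Mathlib.AlgebraicGeometry.Morphisms.Proper
import Mathlib.AlgebraicGeometry.PullbackCarrier
import HarnessLib

/-!
# Universal closedness from a finite jointly surjective family of universally closed schemes

Topic: `Literature/AlgebraicGeometry/Morphisms` (The Stacks Project, Tag 03GN, image of a proper
scheme; EGA II 5.4.3). **If `f : X → S` receives finitely many `S`-morphisms `h_k : V_k → X` whose
images cover `X` and whose composites `V_k → X → S` are universally closed, then `f` is universally
closed** (`universallyClosed_of_finite_cover`): after a base change `S' → S` the images of the
`V_k ×_X X' → X'` still cover `X'`, so the image of a closed subset of `X'` in `S'` is the finite union of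
its images through the closed maps `V_k ×_X X' → S'`. With one `h` this is Mathlib's
`UniversallyClosed.of_comp_surjective`; the finite family avoids forming coproducts of schemes.
Corollary `isProper_of_finite_cover`: `f` separated and of finite type with such a family of proper
`V_k → S` is proper.

Everything is proved; no named facts.

## References

* The Stacks Project, Tag 03GN (Morphisms, Lemma 29.41.9), Tag 01W0. [StacksProject]
* A. Grothendieck, J. Dieudonné, EGA II (1961), Cor. 5.4.3.
-/

noncomputable section

universe u

open CategoryTheory CategoryTheory.Limits AlgebraicGeometry TopologicalSpace

namespace Literature.AlgebraicGeometry.Morphisms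

set_option backward.isDefEq.respectTransparency false

/-- **Universal closedness from a finite jointly surjective family of universally closed schemes over
the target.** [cite: StacksProject, Tag 03GN (Morphisms, Lemma 29.41.9)] -/
theorem universallyClosed_of_finite_cover {X S : Scheme.{u}} (f : X ⟶ S) {ι : Type*} [Finite ι]
    {V : ι → Scheme.{u}} (h : ∀ k, V k ⟶ X) [∀ k, UniversallyClosed (h k ≫ f)]
    (hcov : ∀ x : X, ∃ k, x ∈ Set.range (h k)) : UniversallyClosed f := by
  refine ⟨fun X' S' i₁ i₂ f' H => ?_⟩
  -- base change of the family
  let h' : ∀ k, pullback (h k) i₁ ⟶ X' := fun k => pullback.snd (h k) i₁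
  have hsq : ∀ k, IsPullback (h' k ≫ f') (pullback.fst (h k) i₁) i₂ (h k ≫ f) := fun k =>
    ((IsPullback.of_hasPullback (h k) i₁).paste_vert H.flip).flip
  have hclosed : ∀ k, IsClosedMap (h' k ≫ f') := fun k =>
    UniversallyClosed.universally_isClosedMap _ _ _ (hsq k)
  have hcov' : ∀ x' : X', ∃ k, x' ∈ Set.range (h' k) := fun x' => by
    obtain ⟨k, v, hv⟩ := hcov (i₁ x')
    obtain ⟨w, -, hw⟩ := Scheme.Pullback.exists_preimage_pullback (f := h k) (g := i₁) v x' hv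
    exact ⟨k, w, hw⟩
  intro C hC
  have heq : f' '' C = ⋃ k, (h' k ≫ f') '' ((h' k) ⁻¹' C) := by
    ext s
    simp only [Set.mem_image, Set.mem_iUnion, Set.mem_preimage]
    constructor
    · rintro ⟨x', hx', rfl⟩
      obtain ⟨k, w, rfl⟩ := hcov' x'
      exact ⟨k, w, hx', (Scheme.Hom.comp_apply _ _ _).symm⟩
    · rintro ⟨k, w, hw, rfl⟩
      exact ⟨h' k w, hw, (Scheme.Hom.comp_apply _ _ _).symm⟩
  change IsClosed (f' '' C)
  rw [heq]
  exact isClosed_iUnion_of_finite fun k => hclosed k _ (hC.preimage (h' k).continuous)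

/-- **Properness from a finite jointly surjective family of proper schemes over the target**: a
separated morphism of finite type `f : X → S` receiving finitely many `S`-morphisms from proper
`S`-schemes whose images cover `X` is proper. [cite: StacksProject, Tag 03GN (Morphisms, Lemma 29.41.9)] -/
theorem isProper_of_finite_cover {X S : Scheme.{u}} (f : X ⟶ S) [IsSeparated f] [LocallyOfFiniteType f]
    [QuasiCompact f] {ι : Type*} [Finite ι] {V : ι → Scheme.{u}} (h : ∀ k, V k ⟶ X)
    [∀ k, IsProper (h k ≫ f)] (hcov : ∀ x : X, ∃ k, x ∈ Set.range (h k)) : IsProper f :=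
  haveI := universallyClosed_of_finite_cover f h hcov
  ⟨⟩

end Literature.AlgebraicGeometry.Morphisms

end
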